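import Summits.QuantumFields.YangMills.Theorems.AllWindowsColdBoxGaussSideFourthMoment
import Summits.QuantumFields.YangMills.Theorems.AllWindowsColdBoxGaussSideCovariance
import Summits.QuantumFields.YangMills.Theorems.AllWindowsColdBoxGaussSideCovarianceTransfer
import Summits.QuantumFields.YangMills.Theorems.AllWindowsColdBoxGaussSideLocalMoments
import Summits.QuantumFields.YangMills.Theorems.AllWindowsColdBoxGaussSideLocal
import Summits.QuantumFields.YangMills.Theorems.AllWindowsColdBoxTiltMomentsThresholds
import Summits.QuantumFields.YangMills.Theorems.AllWindowsColdBoxTiltMomentsOfCubic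
import Summits.QuantumFields.YangMills.Theorems.AllWindowsColdBoxTiltCubicVariance
import Summits.QuantumFields.YangMills.Theorems.AllWindowsColdBoxTiltCubicOnSingleton
import Summits.QuantumFields.YangMills.Theorems.AllWindowsColdBoxTiltCubicCap
import Summits.QuantumFields.YangMills.Theorems.AllWindowsColdBoxTiltCubicIntegrable
import Summits.QuantumFields.YangMills.Theorems.AllWindowsColdBoxTiltDominatorsMoments
import Summits.QuantumFields.YangMills.Theorems.AllWindowsColdBoxTiltDominators
import Summits.QuantumFields.YangMills.Theorems.AllWindowsColdBoxPlaqCostCubicTaylor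
import Summits.QuantumFields.YangMills.Theorems.AllWindowsColdBoxLineGaussToolkit
import Summits.QuantumFields.YangMills.Theorems.ColdBoxAllGroupsBulkAllGroupsDlrPlumbingG
import Summits.QuantumFields.YangMills.Theorems.ColdBoxAllGroupsBulkAllGroupsKernelCovCoreMomentsG
import Summits.QuantumFields.YangMills.Theorems.ColdBoxAllGroupsBoxFloorAllGroupsGaussSideD
import Summits.QuantumFields.YangMills.Theorems.WeakCouplingRatesColdBoxGaussMoments
import Summits.QuantumFields.YangMills.Theorems.WeakCouplingRatesColdBoxDirichletShiftedMean
import Summits.QuantumFields.YangMills.Theorems.WeakCouplingRatesColdBoxDirichletRestrictedCov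
import Summits.QuantumFields.YangMills.Theorems.WeakCouplingRatesColdBoxTiltBound
import Summits.QuantumFields.YangMills.Theorems.AllWindowsColdBoxGaussSideTiltTransfer
import Summits.QuantumFields.YangMills.Theorems.AllWindowsColdBoxGaussSideTiltPrelims
import Mathlib.Algebra.Order.Chebyshev
import HarnessLib

/-!
# LINE-17 «hypercontractive second-order tilt expansion» on crux `AllWindowsColdBox.BoxMidWindowsSU22` (stmt-QuantumFields-24003):
# F(iii) of stub F `stub_gaussSideTerms` — the first-order tilt term (STUB-PLAN-E §5 F(iii))

`GaussSideTerms θ` (iii): for every admissible single-link density, eventually in `β`, for all `T ≤ ⌈β^θ⌉`,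
`|∫ (obsF − E_ν obsF)(obsG T − E_ν obsG T)·centredTilt dν| ≤ K⌈β^θ⌉⁶/β` (`ν = lineGauss θ β`).  **`gaussSide_tiltTerm`** proves it
by feeding the engine `abs_integral_centred_mul_mul_tilt_le` (`…GaussSideTiltTransfer`) with: the per-plaquette packages
**`localDecompositionFour`** (observable bounded by `4β`; `qObsD` even with `∫q⁴dγ ≤ 840D⁴`, `∫q⁸dγ ≤ 2027025D⁸/256`; local cubic
term `∫c⁴dγ ≤ 6⁴4¹²10395·16⁶D⁶⌈β^θ⌉⁶/β²`; quartic remainder `∫r⁴dγ ≤ 560⁴4⁴2027025·16⁸D⁸⌈β^θ⌉⁸/β⁴`; E(0) `|q − f − c| ≤ r` on the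
event); F(i) `gaussSide_fourthMoment` (centred fourth moments); the cubic chaos `V = tiltCubicW` (odd: `tiltCubicW_neg`; even
moments: `tiltCubicW_moment_package`, thresholds `eventually_tiltTermThresholds`); and `T = tiltWE` with the E(4) dominator
`X = 13440β·Σ‖a_e‖⁴ + 2C₂·Σ‖a_e‖²` (`abs_tiltWE_sub_tiltCubicW_sub_log_le`, `remainder_le_sum_norm_pow_four`,
`abs_sum_log_le_sum_norm_sq_of_admissible`, second moments `integral_sq_{quartic,quadratic}_dominator_le`, `domX_algebra`).

No definition; standard axioms.  HONEST LABEL: one third of the OPEN registered stub F of one critic-PASSed line on the R2ξ″ RECORD-rung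
crux 24003; no stub by name, no crux, rung or summit; the Yang–Mills mass gap is NOT proved by this file.
-/

set_option autoImplicit false

noncomputable section

open MeasureTheory ProbabilityTheory Finset
open scoped Matrix Matrix.Norms.Frobenius
open Literature.MathematicalPhysics.QuantumLattice
open Literature.MathematicalPhysics.QuantumFieldTheory
open Literature.MathematicalPhysics.QuantumFieldTheory.LatticeMaxwell
open Summit.QuantumFields.YangMills.Theorems.WeakCouplingRates
open Summit.QuantumFields.YangMills.Theorems.ColdBoxAllGroups
open Summit.QuantumFields.YangMills.Theorems.FreeEnergyLogCoefficient

namespace Summit.QuantumFields.YangMills.Theorems.AllWindowsColdBoxBoxMidLine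



section Main

/-- **The local decomposition package of ONE plaquette `(x,1,2)` touching the cold box, F(iii) version** (eventually in `β`,
`0 < θ ≤ 1/16`; `H = ⌈β^θ⌉`, `γ = gaussD H D`): the observable `f = β·plaqCostAt` is measurable and bounded by `4β`; its quadratic
surrogate `q = qObsD (x,1,2)` is measurable, even, `∫q⁴dγ ≤ 840D⁴`, `∫q⁸dγ ≤ 2027025D⁸/256`; and there are a local cubic term `c`
(`∫c⁴dγ ≤ 6⁴4¹²10395·16⁶·D⁶·H⁶/β²`) and a quartic remainder `r` (`∫r⁴dγ ≤ 560⁴4⁴2027025·16⁸·D⁸·H⁸/β⁴`) with `|q − f − c| ≤ r` on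
`lineEvent θ β`. -/
theorem localDecompositionFour {θ : ℝ} (hθ : 0 < θ) (hθ16 : θ ≤ 1 / 16) :
    ∃ β₀ : ℝ, ∀ β : ℝ, β₀ ≤ β → ∀ x : Literature.Probability.LatticeModels.Site 4,
      ((x, ⟨((1 : Fin 4), (2 : Fin 4)), by decide⟩) : ZdPlaquette 4) ∈ plaquettesTouching (AxialGauge.boxEdges 4 (2 * ⌈β ^ θ⌉₊ + 1)) →
      (Measurable fun t : TSpaceD ⌈β ^ θ⌉₊ (dimE ρ₂) => β * plaqCostAt ρ₂ x 1 2 (cfgTE ρ₂ ⌈β ^ θ⌉₊ β t)) ∧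
      (∀ t : TSpaceD ⌈β ^ θ⌉₊ (dimE ρ₂), |β * plaqCostAt ρ₂ x 1 2 (cfgTE ρ₂ ⌈β ^ θ⌉₊ β t)| ≤ 4 * β) ∧
      Measurable (qObsD ⌈β ^ θ⌉₊ (dimE ρ₂) (x, 1, 2)) ∧
      (∀ t, qObsD ⌈β ^ θ⌉₊ (dimE ρ₂) (x, 1, 2) (-t) = qObsD ⌈β ^ θ⌉₊ (dimE ρ₂) (x, 1, 2) t) ∧
      Integrable (fun t => qObsD ⌈β ^ θ⌉₊ (dimE ρ₂) (x, 1, 2) t ^ 4) (gaussD ⌈β ^ θ⌉₊ (dimE ρ₂)) ∧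
      ∫ t, qObsD ⌈β ^ θ⌉₊ (dimE ρ₂) (x, 1, 2) t ^ 4 ∂(gaussD ⌈β ^ θ⌉₊ (dimE ρ₂)) ≤ 840 * (dimE ρ₂ : ℝ) ^ 4 ∧
      Integrable (fun t => qObsD ⌈β ^ θ⌉₊ (dimE ρ₂) (x, 1, 2) t ^ 8) (gaussD ⌈β ^ θ⌉₊ (dimE ρ₂)) ∧
      ∫ t, qObsD ⌈β ^ θ⌉₊ (dimE ρ₂) (x, 1, 2) t ^ 8 ∂(gaussD ⌈β ^ θ⌉₊ (dimE ρ₂)) ≤ 2027025 * (dimE ρ₂ : ℝ) ^ 8 / 256 ∧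
      ∃ c r : TSpaceD ⌈β ^ θ⌉₊ (dimE ρ₂) → ℝ,
        Integrable (fun t => c t ^ 4) (gaussD ⌈β ^ θ⌉₊ (dimE ρ₂)) ∧
        ∫ t, c t ^ 4 ∂(gaussD ⌈β ^ θ⌉₊ (dimE ρ₂)) ≤
          (6 ^ 4 * 4 ^ 12 * 10395 * 16 ^ 6 * (dimE ρ₂ : ℝ) ^ 6) * (⌈β ^ θ⌉₊ : ℝ) ^ 6 / β ^ 2 ∧
        Integrable (fun t => r t ^ 4) (gaussD ⌈β ^ θ⌉₊ (dimE ρ₂)) ∧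
        ∫ t, r t ^ 4 ∂(gaussD ⌈β ^ θ⌉₊ (dimE ρ₂)) ≤
          (560 ^ 4 * 4 ^ 4 * 2027025 * 16 ^ 8 * (dimE ρ₂ : ℝ) ^ 8) * (⌈β ^ θ⌉₊ : ℝ) ^ 8 / β ^ 4 ∧
        ∀ t ∈ lineEvent θ β, |qObsD ⌈β ^ θ⌉₊ (dimE ρ₂) (x, 1, 2) t - β * plaqCostAt ρ₂ x 1 2 (cfgTE ρ₂ ⌈β ^ θ⌉₊ β t) - c t| ≤ r t := by
  haveI : SecondCountableTopology (Matrix (Fin 2) (Fin 2) ℂ) := inferInstanceAs (SecondCountableTopology (Fin 2 → Fin 2 → ℂ))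
  haveI : SecondCountableTopology SU2 := inferInstance
  have hρc : Continuous ρ₂ := continuous_fundamentalRep (Fin 2)
  have hinj : Function.Injective ρ₂ := fundamentalRep_injective (Fin 2)
  have hρu : ∀ g, ρ₂ g ∈ Matrix.unitaryGroup (Fin 2) ℂ := fundamentalRep_mem_unitaryGroup
  obtain ⟨β₁, hpack⟩ := eventually_lineGauss_package hθ hθ16 (k := 1) le_rfl
  obtain ⟨β₂, hthr⟩ := eventually_expClauseThresholds hθ hθ16 (r₂ := 1) (C₂ := 0) (K₁ := 0) one_pos le_rfl le_rfl
  refine ⟨max β₁ β₂, fun β hβ x hx => ?_⟩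
  obtain ⟨hβ1, -, -, -, -, -⟩ := hpack β ((le_max_left _ _).trans hβ)
  obtain ⟨-, hR4, -, -, -, -, -, -, -⟩ := hthr β ((le_max_right _ _).trans hβ)
  have hβ0 : 0 < β := by linarith
  have hHr : (1 : ℝ) ≤ (⌈β ^ θ⌉₊ : ℝ) := (one_le_ceil_rpow_and_le hβ1 hθ.le).1
  have hH : 1 ≤ ⌈β ^ θ⌉₊ := by exact_mod_cast hHr
  have hES : ∀ t ∈ lineEvent θ β, ∀ e, ‖unscaleTE ⌈β ^ θ⌉₊ (dimE ρ₂) β t e‖ ≤ 2 * etaOf β ⌈β ^ θ⌉₊ (epsOf θ) :=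
    fun t ht e => ht.2 e
  -- the observable
  have hfm : Measurable fun t : TSpaceD ⌈β ^ θ⌉₊ (dimE ρ₂) => β * plaqCostAt ρ₂ x 1 2 (cfgTE ρ₂ ⌈β ^ θ⌉₊ β t) :=
    ((measurable_plaqCostAt_of_continuous ρ₂ hρc x 1 2).comp (measurable_cfgTE ρ₂ hρc hinj β)).const_mul β
  have hfb : ∀ t : TSpaceD ⌈β ^ θ⌉₊ (dimE ρ₂), |β * plaqCostAt ρ₂ x 1 2 (cfgTE ρ₂ ⌈β ^ θ⌉₊ β t)| ≤ 4 * β := by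
    intro t
    rw [abs_mul, abs_of_pos hβ0]
    have h := abs_plaqCostAt_leG ρ₂ hρu x 1 2 (cfgTE ρ₂ ⌈β ^ θ⌉₊ β t)
    norm_num at h
    nlinarith
  -- the quadratic surrogate: fourth and eighth moments
  have hvar := integral_dirCirc_sq_le_one_of_touching (H := ⌈β ^ θ⌉₊) hx
  have hq4 := integral_quadObs_pow_four_piD_le (H := ⌈β ^ θ⌉₊) (D := dimE ρ₂) (fun _ => (0 : ℝ)) ((x, 1, 2) : Plaq 4)
  simp only [zero_add, zero_pow (by norm_num : 8 ≠ 0)] at hq4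
  obtain ⟨hq4I, hq4le⟩ := hq4
  have hK1 : boxDirProjKernel ⌈β ^ θ⌉₊ ((x, 1, 2) : Plaq 4) (x, 1, 2) ≤ 1 := by
    have h := hvar; rw [integral_dirCirc_sq] at h; exact h
  have hK0 : 0 ≤ boxDirProjKernel ⌈β ^ θ⌉₊ ((x, 1, 2) : Plaq 4) (x, 1, 2) := boxDirProjKernel_self_nonneg _
  have hqle : ∫ t, qObsD ⌈β ^ θ⌉₊ (dimE ρ₂) (x, 1, 2) t ^ 4 ∂(gaussD ⌈β ^ θ⌉₊ (dimE ρ₂)) ≤ 840 * (dimE ρ₂ : ℝ) ^ 4 := by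
    refine hq4le.trans ?_
    rw [Finset.sum_const, Finset.card_univ, Fintype.card_fin, nsmul_eq_mul]
    have hK4 : boxDirProjKernel ⌈β ^ θ⌉₊ ((x, 1, 2) : Plaq 4) (x, 1, 2) ^ 4 ≤ 1 := pow_le_one₀ hK0 hK1
    have hD0 : (0 : ℝ) ≤ (dimE ρ₂ : ℝ) := Nat.cast_nonneg _
    nlinarith [pow_nonneg hD0 3, pow_nonneg hD0 4, mul_nonneg (pow_nonneg hD0 4) (sub_nonneg.2 hK4)]
  obtain ⟨hq8I, hq8le⟩ := integral_qObsD_pow_eight_le (H := ⌈β ^ θ⌉₊) (D := dimE ρ₂) ((x, 1, 2) : Plaq 4) hvar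
  -- the local cubic term and the quartic remainder
  obtain ⟨c, hc⟩ : ∃ c : TSpaceD ⌈β ^ θ⌉₊ (dimE ρ₂) → ℝ, c = fun t =>
      β * ((chartCubic ρ₂ (circV (extZero (unscaleTE ⌈β ^ θ⌉₊ (dimE ρ₂) β t)) (x, 1, 2)) (extZero (unscaleTE ⌈β ^ θ⌉₊ (dimE ρ₂) β t) (x, 1))
            (extZero (unscaleTE ⌈β ^ θ⌉₊ (dimE ρ₂) β t) (x + Pi.single 1 1, 2)) -
          chartCubic ρ₂ (circV (extZero (unscaleTE ⌈β ^ θ⌉₊ (dimE ρ₂) β t)) (x, 1, 2)) (extZero (unscaleTE ⌈β ^ θ⌉₊ (dimE ρ₂) β t) (x, 1))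
            (extZero (unscaleTE ⌈β ^ θ⌉₊ (dimE ρ₂) β t) (x + Pi.single 2 1, 1)) -
          chartCubic ρ₂ (circV (extZero (unscaleTE ⌈β ^ θ⌉₊ (dimE ρ₂) β t)) (x, 1, 2)) (extZero (unscaleTE ⌈β ^ θ⌉₊ (dimE ρ₂) β t) (x, 1))
            (extZero (unscaleTE ⌈β ^ θ⌉₊ (dimE ρ₂) β t) (x, 2)) -
          chartCubic ρ₂ (circV (extZero (unscaleTE ⌈β ^ θ⌉₊ (dimE ρ₂) β t)) (x, 1, 2)) (extZero (unscaleTE ⌈β ^ θ⌉₊ (dimE ρ₂) β t) (x + Pi.single 1 1, 2))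
            (extZero (unscaleTE ⌈β ^ θ⌉₊ (dimE ρ₂) β t) (x + Pi.single 2 1, 1)) -
          chartCubic ρ₂ (circV (extZero (unscaleTE ⌈β ^ θ⌉₊ (dimE ρ₂) β t)) (x, 1, 2)) (extZero (unscaleTE ⌈β ^ θ⌉₊ (dimE ρ₂) β t) (x + Pi.single 1 1, 2))
            (extZero (unscaleTE ⌈β ^ θ⌉₊ (dimE ρ₂) β t) (x, 2)) +
          chartCubic ρ₂ (circV (extZero (unscaleTE ⌈β ^ θ⌉₊ (dimE ρ₂) β t)) (x, 1, 2)) (extZero (unscaleTE ⌈β ^ θ⌉₊ (dimE ρ₂) β t) (x + Pi.single 2 1, 1))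
            (extZero (unscaleTE ⌈β ^ θ⌉₊ (dimE ρ₂) β t) (x, 2))) / 2) := ⟨_, rfl⟩
  obtain ⟨r, hr⟩ : ∃ r : TSpaceD ⌈β ^ θ⌉₊ (dimE ρ₂) → ℝ, r = fun t => 560 * β * (‖extZero (unscaleTE ⌈β ^ θ⌉₊ (dimE ρ₂) β t) (x, 1)‖ ^ 4 +
      ‖extZero (unscaleTE ⌈β ^ θ⌉₊ (dimE ρ₂) β t) (x + Pi.single 1 1, 2)‖ ^ 4 + ‖extZero (unscaleTE ⌈β ^ θ⌉₊ (dimE ρ₂) β t) (x + Pi.single 2 1, 1)‖ ^ 4 +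
      ‖extZero (unscaleTE ⌈β ^ θ⌉₊ (dimE ρ₂) β t) (x, 2)‖ ^ 4) := ⟨_, rfl⟩
  have hcm : AEStronglyMeasurable c (gaussD ⌈β ^ θ⌉₊ (dimE ρ₂)) := by
    rw [hc]; exact (continuous_localCubic (H := ⌈β ^ θ⌉₊) x β).measurable.aestronglyMeasurable
  have hcb : ∀ t, |c t| ≤ 6 * β * (‖extZero (unscaleTE ⌈β ^ θ⌉₊ (dimE ρ₂) β t) (x, 1)‖ +
      ‖extZero (unscaleTE ⌈β ^ θ⌉₊ (dimE ρ₂) β t) (x + Pi.single 1 1, 2)‖ + ‖extZero (unscaleTE ⌈β ^ θ⌉₊ (dimE ρ₂) β t) (x + Pi.single 2 1, 1)‖ +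
      ‖extZero (unscaleTE ⌈β ^ θ⌉₊ (dimE ρ₂) β t) (x, 2)‖) ^ 3 := fun t => by
    rw [hc]; exact abs_localCubic_le ρ₂ hβ0.le (extZero (unscaleTE ⌈β ^ θ⌉₊ (dimE ρ₂) β t)) x 1 2
  obtain ⟨hcI, hc4le⟩ := integral_pow_four_le_of_cubic_leg_bound (D := dimE ρ₂) hH hβ0 x 1 2 hcm hcb
  obtain ⟨-, ⟨hrI', hr4le⟩⟩ := integral_remainder_moments_le (H := ⌈β ^ θ⌉₊) (D := dimE ρ₂) hH hβ0 x 1 2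
  have hrI : Integrable (fun t => r t ^ 4) (gaussD ⌈β ^ θ⌉₊ (dimE ρ₂)) := by rw [hr]; exact hrI'
  have hrle : ∫ t, r t ^ 4 ∂(gaussD ⌈β ^ θ⌉₊ (dimE ρ₂)) ≤
      (560 ^ 4 * 4 ^ 4 * 2027025 * 16 ^ 8 * (dimE ρ₂ : ℝ) ^ 8) * (⌈β ^ θ⌉₊ : ℝ) ^ 8 / β ^ 4 := by
    rw [hr]; refine hr4le.trans (le_of_eq ?_); ring
  have hcle : ∫ t, c t ^ 4 ∂(gaussD ⌈β ^ θ⌉₊ (dimE ρ₂)) ≤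
      (6 ^ 4 * 4 ^ 12 * 10395 * 16 ^ 6 * (dimE ρ₂ : ℝ) ^ 6) * (⌈β ^ θ⌉₊ : ℝ) ^ 6 / β ^ 2 := hc4le.trans (le_of_eq (by ring))
  have hdec : ∀ t ∈ lineEvent θ β, |qObsD ⌈β ^ θ⌉₊ (dimE ρ₂) (x, 1, 2) t - β * plaqCostAt ρ₂ x 1 2 (cfgTE ρ₂ ⌈β ^ θ⌉₊ β t) - c t| ≤ r t := by
    intro t ht
    have h4 : ∀ e, ‖unscaleTE ⌈β ^ θ⌉₊ (dimE ρ₂) β t e‖ ≤ 1 / 4 := fun e => (hES t ht e).trans hR4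
    rw [hc, hr]; exact abs_qObsD_sub_beta_mul_plaqCostAt_sub_cubic_le ρ₂ hρc hβ0 t h4 x 1 2
  exact ⟨hfm, hfb, ColdBoxAllGroups.measurable_qObsD (H := ⌈β ^ θ⌉₊) (dimE ρ₂) ((x, 1, 2) : Plaq 4),
    fun t => qObsD_neg (H := ⌈β ^ θ⌉₊) (dimE ρ₂) ((x, 1, 2) : Plaq 4) t, hq4I, hqle, hq8I, hq8le,
    c, r, hcI, hcle, hrI, hrle, hdec⟩

/-- **F(iii) of `GaussSideTerms θ`** (`0 < θ ≤ 1/16`): for every admissible single-link density `J`, eventually in `β`, for all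
`T ≤ ⌈β^θ⌉`, `|∫ (obsF − E_ν obsF)(obsG T − E_ν obsG T)·centredTilt dν| ≤ K·⌈β^θ⌉⁶/β`.
Proof: the engine `abs_integral_centred_mul_mul_tilt_le` on: the two packages `localDecompositionFour` (plaquettes touch the box,
`centre_mem_plaquettesTouching`); F(i) `gaussSide_fourthMoment` (centred fourth moments); `V = tiltCubicW` (odd, `tiltCubicW_neg`;
even moments from `tiltCubicW_moment_package`, `k = 1, 2`; thresholds `eventually_tiltTermThresholds`); `T = tiltWE` with the E(4)
dominator `X = 13440β·Σ‖a_e‖⁴ + 2C₂·Σ‖a_e‖²` (`abs_tiltWE_sub_tiltCubicW_sub_log_le`, `remainder_le_sum_norm_pow_four`,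
`abs_sum_log_le_sum_norm_sq_of_admissible`; second moments `integral_sq_{quartic,quadratic}_dominator_le`, `domX_algebra`). -/
theorem gaussSide_tiltTerm {θ : ℝ} (hθ : 0 < θ) (hθ16 : θ ≤ 1 / 16) {r₂ C₂ : ℝ} {J : EuclideanSpace ℝ (Fin (dimE ρ₂)) → ℝ}
    (hJ : AdmissibleDensity r₂ C₂ J) :
    ∃ K β₀ : ℝ, 0 ≤ K ∧ ∀ β : ℝ, β₀ ≤ β → ∀ T : ℕ, T ≤ ⌈β ^ θ⌉₊ →
      |∫ t, (obsF θ β t - ∫ s, obsF θ β s ∂(lineGauss θ β)) * (obsG θ β T t - ∫ s, obsG θ β T s ∂(lineGauss θ β)) *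
          centredTilt θ β J t ∂(lineGauss θ β)| ≤ K * (⌈β ^ θ⌉₊ : ℝ) ^ 6 / β := by
  haveI : SecondCountableTopology (Matrix (Fin 2) (Fin 2) ℂ) := inferInstanceAs (SecondCountableTopology (Fin 2 → Fin 2 → ℂ))
  haveI : SecondCountableTopology SU2 := inferInstance
  have hρc : Continuous ρ₂ := continuous_fundamentalRep (Fin 2)
  have hinj : Function.Injective ρ₂ := fundamentalRep_injective (Fin 2)
  obtain ⟨hr₂, hC₂, hJc, -, -⟩ := id hJ
  obtain ⟨K₁, hK₁, hVK⟩ := tiltCubicW_moment_package ρ₂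
  obtain ⟨KF, βF, hKF, hF⟩ := gaussSide_fourthMoment hθ hθ16
  have hD0 : (0 : ℝ) ≤ (dimE ρ₂ : ℝ) := Nat.cast_nonneg _
  -- the constants of the engine
  have hA4 : (0 : ℝ) ≤ 840 * (dimE ρ₂ : ℝ) ^ 4 := by positivity
  have hA8 : (0 : ℝ) ≤ 2027025 * (dimE ρ₂ : ℝ) ^ 8 / 256 := by positivity
  have hCc4 : (0 : ℝ) ≤ 6 ^ 4 * 4 ^ 12 * 10395 * 16 ^ 6 * (dimE ρ₂ : ℝ) ^ 6 := by positivity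
  have hCr4 : (0 : ℝ) ≤ 560 ^ 4 * 4 ^ 4 * 2027025 * 16 ^ 8 * (dimE ρ₂ : ℝ) ^ 8 := by positivity
  obtain ⟨βE, heng⟩ := abs_integral_centred_mul_mul_tilt_le hθ hθ16 (F4 := KF ^ 4) (CV := 729 * K₁ ^ 2 * 5 ^ 12)
    (CX := 2 * 13440 ^ 2 * 105 * (dimE ρ₂ : ℝ) ^ 4 * 2500 ^ 2 * 16 ^ 4 + 2 * 4 * C₂ ^ 2 * 3 * (dimE ρ₂ : ℝ) ^ 2 * 2500 ^ 2 * 16 ^ 2)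
    hA4 hA8 hCc4 hCr4
  obtain ⟨βL, hloc⟩ := localDecompositionFour hθ hθ16
  obtain ⟨β₁, hpack⟩ := eventually_lineGauss_package hθ hθ16 (k := 1) le_rfl
  obtain ⟨β₂, hthr⟩ := eventually_expClauseThresholds hθ hθ16 hr₂ hC₂.le hK₁
  obtain ⟨β₃, hthr3⟩ := eventually_tiltTermThresholds hθ hθ16 K₁
  refine ⟨?_, max (max (max βE βL) (max βF β₁)) (max β₂ β₃), ?_, fun β hβ T hT => ?_⟩
  rotate_left 2
  · have hβE : βE ≤ β := le_trans (le_max_left _ _) (le_trans (le_max_left _ _) (le_trans (le_max_left _ _) hβ))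
    have hβL : βL ≤ β := le_trans (le_max_right _ _) (le_trans (le_max_left _ _) (le_trans (le_max_left _ _) hβ))
    have hβF : βF ≤ β := le_trans (le_max_left _ _) (le_trans (le_max_right _ _) (le_trans (le_max_left _ _) hβ))
    have hβ₁ : β₁ ≤ β := le_trans (le_max_right _ _) (le_trans (le_max_right _ _) (le_trans (le_max_left _ _) hβ))
    have hβ₂ : β₂ ≤ β := le_trans (le_max_left _ _) (le_trans (le_max_right _ _) hβ)
    have hβ₃ : β₃ ≤ β := le_trans (le_max_right _ _) (le_trans (le_max_right _ _) hβ)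
    obtain ⟨hβ1, hνP, -, -, -, -⟩ := hpack β hβ₁
    obtain ⟨-, hR4, hRr, -, -, -, -, -, -⟩ := hthr β hβ₂
    obtain ⟨-, hV4one, hV2one⟩ := hthr3 β hβ₃
    have hβ0 : 0 < β := by linarith
    have hHr : (1 : ℝ) ≤ (⌈β ^ θ⌉₊ : ℝ) := (one_le_ceil_rpow_and_le hβ1 hθ.le).1
    have hH : 1 ≤ ⌈β ^ θ⌉₊ := by exact_mod_cast hHr
    haveI : IsProbabilityMeasure (lineGauss θ β) := hνP
    have hES : ∀ t ∈ lineEvent θ β, ∀ e, ‖unscaleTE ⌈β ^ θ⌉₊ (dimE ρ₂) β t e‖ ≤ 2 * etaOf β ⌈β ^ θ⌉₊ (epsOf θ) :=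
      fun t ht e => ht.2 e
    obtain ⟨hxm, hym⟩ := centre_mem_plaquettesTouching hH hT
    -- the two plaquette packages
    obtain ⟨hfm, hfb, hqfm, hqfe, hqf4, hqf4le, hqf8, hqf8le, cf, rf, hcf4, hcf4le, hrf4, hrf4le, hdf⟩ := hloc β hβL _ hxm
    obtain ⟨hgm, hgb, hqgm, hqge, hqg4, hqg4le, hqg8, hqg8le, cg, rg, hcg4, hcg4le, hrg4, hrg4le, hdg⟩ := hloc β hβL _ hym
    -- F(i): centred fourth moments
    have hF4f := le_pow_four_of_rpow_quarter_le (integral_nonneg fun t => Even.pow_nonneg (by decide) _) (hF β hβF _ hxm)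
    have hF4g := le_pow_four_of_rpow_quarter_le (integral_nonneg fun t => Even.pow_nonneg (by decide) _) (hF β hβF _ hym)
    -- V = tiltCubicW: odd, moments from the package
    obtain ⟨hmom, hint⟩ := hVK ⌈β ^ θ⌉₊ β hH hβ0
    have hVm : Measurable (tiltCubicW ρ₂ ⌈β ^ θ⌉₊ β) := measurable_tiltCubicW ρ₂ β
    have hVo : ∀ t, tiltCubicW ρ₂ ⌈β ^ θ⌉₊ β (-t) = -tiltCubicW ρ₂ ⌈β ^ θ⌉₊ β t := fun t => tiltCubicW_neg ρ₂ hβ0 t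
    have hV4 : Integrable (fun t => tiltCubicW ρ₂ ⌈β ^ θ⌉₊ β t ^ 4) (gaussD ⌈β ^ θ⌉₊ (dimE ρ₂)) := by
      have h := hint 2; simp only [show 2 * 2 = 4 by norm_num] at h; exact h
    have hS5 : 2 * (⌈β ^ θ⌉₊ : ℝ) + 3 ≤ 5 * (⌈β ^ θ⌉₊ : ℝ) := by linarith
    have hS0 : 0 ≤ 2 * (⌈β ^ θ⌉₊ : ℝ) + 3 := by positivity
    have hV4le' : ∫ t, tiltCubicW ρ₂ ⌈β ^ θ⌉₊ β t ^ 4 ∂(gaussD ⌈β ^ θ⌉₊ (dimE ρ₂)) ≤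
        729 * K₁ ^ 2 * (2 * (⌈β ^ θ⌉₊ : ℝ) + 3) ^ 12 / β ^ 2 := by
      have h := hmom 2 (by norm_num)
      simp only [show 2 * 2 = 4 by norm_num] at h
      refine h.trans (le_of_eq ?_)
      norm_num; ring
    have hV4le : ∫ t, tiltCubicW ρ₂ ⌈β ^ θ⌉₊ β t ^ 4 ∂(gaussD ⌈β ^ θ⌉₊ (dimE ρ₂)) ≤
        729 * K₁ ^ 2 * 5 ^ 12 * (⌈β ^ θ⌉₊ : ℝ) ^ 12 / β ^ 2 := by
      refine hV4le'.trans ?_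
      have h12 : (2 * (⌈β ^ θ⌉₊ : ℝ) + 3) ^ 12 ≤ (5 * (⌈β ^ θ⌉₊ : ℝ)) ^ 12 := pow_le_pow_left₀ hS0 hS5 12
      rw [mul_pow] at h12
      have := mul_le_mul_of_nonneg_left h12 (by positivity : (0 : ℝ) ≤ 729 * K₁ ^ 2)
      rw [div_le_div_iff_of_pos_right (by positivity)]
      nlinarith [this]
    have hV41 : ∫ t, tiltCubicW ρ₂ ⌈β ^ θ⌉₊ β t ^ 4 ∂(gaussD ⌈β ^ θ⌉₊ (dimE ρ₂)) ≤ 1 := hV4le'.trans hV4one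
    have hV21 : ∫ t, tiltCubicW ρ₂ ⌈β ^ θ⌉₊ β t ^ 2 ∂(gaussD ⌈β ^ θ⌉₊ (dimE ρ₂)) ≤ 1 := by
      have h := hmom 1 le_rfl
      simp only [show 2 * 1 = 2 by norm_num] at h
      refine (h.trans (le_of_eq ?_)).trans hV2one
      norm_num
    -- T = tiltWE and its E(4) dominator X
    have hTm : Measurable (tiltWE ρ₂ ⌈β ^ θ⌉₊ J β) := measurable_tiltWE ρ₂ hρc hinj hJc.measurable β
    obtain ⟨X, hX⟩ : ∃ φ : TSpaceD ⌈β ^ θ⌉₊ (dimE ρ₂) → ℝ, φ = fun t =>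
        13440 * β * ∑ e : ColdFreeIdx ⌈β ^ θ⌉₊, ‖unscaleTE ⌈β ^ θ⌉₊ (dimE ρ₂) β t e‖ ^ 4 +
        2 * C₂ * ∑ e : ColdFreeIdx ⌈β ^ θ⌉₊, ‖unscaleTE ⌈β ^ θ⌉₊ (dimE ρ₂) β t e‖ ^ 2 := ⟨_, rfl⟩
    have hX₂m : Measurable fun t : TSpaceD ⌈β ^ θ⌉₊ (dimE ρ₂) =>
        13440 * β * ∑ e : ColdFreeIdx ⌈β ^ θ⌉₊, ‖unscaleTE ⌈β ^ θ⌉₊ (dimE ρ₂) β t e‖ ^ 4 :=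
      (measurable_sum_norm_unscaleTE_pow β 4).const_mul _
    have hX₃m : Measurable fun t : TSpaceD ⌈β ^ θ⌉₊ (dimE ρ₂) =>
        2 * C₂ * ∑ e : ColdFreeIdx ⌈β ^ θ⌉₊, ‖unscaleTE ⌈β ^ θ⌉₊ (dimE ρ₂) β t e‖ ^ 2 :=
      (measurable_sum_norm_unscaleTE_pow β 2).const_mul _
    have hXm : AEStronglyMeasurable X (gaussD ⌈β ^ θ⌉₊ (dimE ρ₂)) := by rw [hX]; exact (hX₂m.add hX₃m).aestronglyMeasurable
    have hTV : ∀ t ∈ lineEvent θ β, |tiltWE ρ₂ ⌈β ^ θ⌉₊ J β t - tiltCubicW ρ₂ ⌈β ^ θ⌉₊ β t| ≤ X t := by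
      intro t ht
      have h4 : ∀ e, ‖unscaleTE ⌈β ^ θ⌉₊ (dimE ρ₂) β t e‖ ≤ 1 / 4 := fun e => (hES t ht e).trans hR4
      have hr : ∀ e, ‖unscaleTE ⌈β ^ θ⌉₊ (dimE ρ₂) β t e‖ ≤ r₂ := fun e => (hES t ht e).trans hRr
      have h0 := abs_tiltWE_sub_tiltCubicW_sub_log_le ρ₂ hρc hβ0 J t h4
      have hrem := remainder_le_sum_norm_pow_four hβ0.le t (plaquettesTouching (AxialGauge.boxEdges 4 (2 * ⌈β ^ θ⌉₊ + 1)))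
      have hlog := abs_sum_log_le_sum_norm_sq_of_admissible hJ β t hr
      rw [hX]
      have htri := abs_sub_le (tiltWE ρ₂ ⌈β ^ θ⌉₊ J β t)
        (tiltCubicW ρ₂ ⌈β ^ θ⌉₊ β t + ∑ e : ColdFreeIdx ⌈β ^ θ⌉₊, Real.log (J (unscaleTE ⌈β ^ θ⌉₊ (dimE ρ₂) β t e)))
        (tiltCubicW ρ₂ ⌈β ^ θ⌉₊ β t)
      rw [show tiltWE ρ₂ ⌈β ^ θ⌉₊ J β t - (tiltCubicW ρ₂ ⌈β ^ θ⌉₊ β t +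
          ∑ e : ColdFreeIdx ⌈β ^ θ⌉₊, Real.log (J (unscaleTE ⌈β ^ θ⌉₊ (dimE ρ₂) β t e))) =
          tiltWE ρ₂ ⌈β ^ θ⌉₊ J β t - tiltCubicW ρ₂ ⌈β ^ θ⌉₊ β t -
          ∑ e : ColdFreeIdx ⌈β ^ θ⌉₊, Real.log (J (unscaleTE ⌈β ^ θ⌉₊ (dimE ρ₂) β t e)) by ring,
        show tiltCubicW ρ₂ ⌈β ^ θ⌉₊ β t + ∑ e : ColdFreeIdx ⌈β ^ θ⌉₊, Real.log (J (unscaleTE ⌈β ^ θ⌉₊ (dimE ρ₂) β t e)) -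
          tiltCubicW ρ₂ ⌈β ^ θ⌉₊ β t = ∑ e : ColdFreeIdx ⌈β ^ θ⌉₊, Real.log (J (unscaleTE ⌈β ^ θ⌉₊ (dimE ρ₂) β t e)) by ring] at htri
      linarith
    -- second moment of X
    have hX₂2 : Integrable (fun t : TSpaceD ⌈β ^ θ⌉₊ (dimE ρ₂) =>
        (13440 * β * ∑ e : ColdFreeIdx ⌈β ^ θ⌉₊, ‖unscaleTE ⌈β ^ θ⌉₊ (dimE ρ₂) β t e‖ ^ 4) ^ 2) (gaussD ⌈β ^ θ⌉₊ (dimE ρ₂)) :=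
      integrable_sum_norm_unscaleTE_pow_four_pow hβ0.le _ 2
    have hX₃2 : Integrable (fun t : TSpaceD ⌈β ^ θ⌉₊ (dimE ρ₂) =>
        (2 * C₂ * ∑ e : ColdFreeIdx ⌈β ^ θ⌉₊, ‖unscaleTE ⌈β ^ θ⌉₊ (dimE ρ₂) β t e‖ ^ 2) ^ 2) (gaussD ⌈β ^ θ⌉₊ (dimE ρ₂)) :=
      integrable_sum_norm_unscaleTE_sq_pow hβ0.le _ 2
    have hS2 : Integrable (fun t : TSpaceD ⌈β ^ θ⌉₊ (dimE ρ₂) =>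
        (13440 * β * ∑ e : ColdFreeIdx ⌈β ^ θ⌉₊, ‖unscaleTE ⌈β ^ θ⌉₊ (dimE ρ₂) β t e‖ ^ 4) ^ 2 +
        (2 * C₂ * ∑ e : ColdFreeIdx ⌈β ^ θ⌉₊, ‖unscaleTE ⌈β ^ θ⌉₊ (dimE ρ₂) β t e‖ ^ 2) ^ 2) (gaussD ⌈β ^ θ⌉₊ (dimE ρ₂)) := hX₂2.add hX₃2
    have hR2 : Integrable (fun t : TSpaceD ⌈β ^ θ⌉₊ (dimE ρ₂) =>
        2 * ((13440 * β * ∑ e : ColdFreeIdx ⌈β ^ θ⌉₊, ‖unscaleTE ⌈β ^ θ⌉₊ (dimE ρ₂) β t e‖ ^ 4) ^ 2 +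
        (2 * C₂ * ∑ e : ColdFreeIdx ⌈β ^ θ⌉₊, ‖unscaleTE ⌈β ^ θ⌉₊ (dimE ρ₂) β t e‖ ^ 2) ^ 2)) (gaussD ⌈β ^ θ⌉₊ (dimE ρ₂)) := hS2.const_mul 2
    have hXpt : ∀ t, X t ^ 2 ≤ 2 * ((13440 * β * ∑ e : ColdFreeIdx ⌈β ^ θ⌉₊, ‖unscaleTE ⌈β ^ θ⌉₊ (dimE ρ₂) β t e‖ ^ 4) ^ 2 +
        (2 * C₂ * ∑ e : ColdFreeIdx ⌈β ^ θ⌉₊, ‖unscaleTE ⌈β ^ θ⌉₊ (dimE ρ₂) β t e‖ ^ 2) ^ 2) := fun t => by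
      have hab : ∀ a b : ℝ, (a + b) ^ 2 ≤ 2 * (a ^ 2 + b ^ 2) := fun a b => by
        linarith only [sq_nonneg (a - b), (by ring : (a + b) ^ 2 = a ^ 2 + 2 * a * b + b ^ 2),
          (by ring : (a - b) ^ 2 = a ^ 2 - 2 * a * b + b ^ 2)]
      rw [hX]
      exact hab _ _
    have hX2 : Integrable (fun t => X t ^ 2) (gaussD ⌈β ^ θ⌉₊ (dimE ρ₂)) :=
      hR2.mono' (hXm.pow 2) (ae_of_all _ fun t => by rw [Real.norm_eq_abs, abs_of_nonneg (sq_nonneg _)]; exact hXpt t)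
    obtain ⟨-, hNE, -⟩ := boxSide_facts ⌈β ^ θ⌉₊
    have hX2le : ∫ t, X t ^ 2 ∂(gaussD ⌈β ^ θ⌉₊ (dimE ρ₂)) ≤
        (2 * 13440 ^ 2 * 105 * (dimE ρ₂ : ℝ) ^ 4 * 2500 ^ 2 * 16 ^ 4 + 2 * 4 * C₂ ^ 2 * 3 * (dimE ρ₂ : ℝ) ^ 2 * 2500 ^ 2 * 16 ^ 2) *
          (⌈β ^ θ⌉₊ : ℝ) ^ 12 / β ^ 2 := by
      have h1 := integral_mono hX2 hR2 hXpt
      have h2 : ∫ t, 2 * ((13440 * β * ∑ e : ColdFreeIdx ⌈β ^ θ⌉₊, ‖unscaleTE ⌈β ^ θ⌉₊ (dimE ρ₂) β t e‖ ^ 4) ^ 2 +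
          (2 * C₂ * ∑ e : ColdFreeIdx ⌈β ^ θ⌉₊, ‖unscaleTE ⌈β ^ θ⌉₊ (dimE ρ₂) β t e‖ ^ 2) ^ 2) ∂(gaussD ⌈β ^ θ⌉₊ (dimE ρ₂)) =
          2 * (∫ t, (13440 * β * ∑ e : ColdFreeIdx ⌈β ^ θ⌉₊, ‖unscaleTE ⌈β ^ θ⌉₊ (dimE ρ₂) β t e‖ ^ 4) ^ 2 ∂(gaussD ⌈β ^ θ⌉₊ (dimE ρ₂))) +
          2 * ∫ t, (2 * C₂ * ∑ e : ColdFreeIdx ⌈β ^ θ⌉₊, ‖unscaleTE ⌈β ^ θ⌉₊ (dimE ρ₂) β t e‖ ^ 2) ^ 2 ∂(gaussD ⌈β ^ θ⌉₊ (dimE ρ₂)) := by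
        rw [integral_const_mul, integral_add hX₂2 hX₃2, mul_add]
      have h3 := integral_sq_quartic_dominator_le (D := dimE ρ₂) hH hβ0 (13440 * β)
      have h4 := integral_sq_quadratic_dominator_le (D := dimE ρ₂) hH hβ0 (2 * C₂)
      have h5 := domX_algebra (D := (dimE ρ₂ : ℝ)) (C₂ := C₂) hβ0 hHr (Nat.cast_nonneg _) hNE
      linarith only [h1, h2, h3, h4, h5]
    -- the engine
    have key := heng β hβE (4 * β) _ _ _ _ cf cg rf rg (tiltCubicW ρ₂ ⌈β ^ θ⌉₊ β) (tiltWE ρ₂ ⌈β ^ θ⌉₊ J β) X hfm hgm hfb hgb hF4f hF4g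
      hqfm hqgm hqfe hqge hqf4 hqg4 hqf4le hqg4le hqf8 hqg8 hqf8le hqg8le hcf4 hcg4 hcf4le hcg4le hrf4 hrg4 hrf4le hrg4le hdf hdg hVm hVo hV4
      hV4le hV41 hV21 hTm hXm hX2 hX2le hTV
    unfold obsF obsG centredTilt
    rw [mul_div_assoc]
    exact key
  · positivity

end Main



end Summit.QuantumFields.YangMills.Theorems.AllWindowsColdBoxBoxMidLine

end
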